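import Summits.ResolutionOfSingularities.ResolutionOfSingularities.Theorems.FrobeniusLadderFInjectiveMacaulayficationHypersurfaceRegular
import Mathlib.Algebra.MvPolynomial.PDeriv
import Mathlib.Algebra.CharP.Lemmas
import HarnessLib

/-!
# Charts `0`, `1`, `2` of the blown-up threefold are regular along the exceptional divisor

Support file for crux stmt-ResolutionOfSingularities-15315 (`FrobeniusLadder.FInjectiveMacaulayfication`,
line `Sketch`, lead seat c7, cycle 8): stub `stub_threefoldChartsAlongE` of the §13 THREEFOLD CALIBRATION
package (dimension `3`, characteristic `2`). The point blow-up of the origin of the hypersurface germ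
`f = X₀²X₁ + X₁²X₂ + X₂²X₀ + X₀X₃³ + X₁X₂X₃²` in `𝔸⁴` has four charts; on the `Xᵢ`-chart the strict
transform is the hypersurface `k[X₀, …, X₃]/(gᵢ)` (`θᵢ f = Xᵢ³ gᵢ`) and the exceptional divisor `E` is
`Xᵢ = 0`. For the first three charts

* `g₀ = X₁ + X₁²X₂ + X₂² + X₀X₃³ + X₀X₁X₂X₃²`,
* `g₁ = X₀² + X₂ + X₀X₂² + X₀X₁X₃³ + X₁X₂X₃²`,
* `g₂ = X₀²X₁ + X₁² + X₀ + X₀X₂X₃³ + X₁X₂X₃²`,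

EVERY point of `E` is a regular point of the chart, by the Jacobian criterion in one direction:

* `pderiv_one_g₀`, `pderiv_two_g₁`, `pderiv_zero_g₂` — over any commutative ring,
  `∂g₀/∂X₁ = 1 + X₀ · (X₂X₃²) + 2 · (X₁X₂)`, `∂g₁/∂X₂ = 1 + X₁ · X₃² + 2 · (X₀X₂)`,
  `∂g₂/∂X₀ = 1 + X₂ · X₃³ + 2 · (X₀X₁)`;
* `one_add_mul_add_two_mul_not_mem` — in characteristic `2`, `1 + x · a + 2 · b ∉ P` for every proper
  ideal `P ∋ x` (as `2 = 0`, otherwise `1 = (1 + x · a) - x · a ∈ P`);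
* `stub_threefoldChartsAlongE` — the registered form: for a prime `Q ∋ x̄ᵢ` of `k[X]/(gᵢ)` the prime
  `P := Q ∩ k[X]` is proper and contains `Xᵢ`, so the certified partial derivative is not in `P`, and
  the Jacobian criterion at an arbitrary prime (`HypersurfaceRegular.stub_hypersurfaceRegularOfPderiv`,
  Matsumura Thm. 30.4 (ii)) makes `(k[X]/(gᵢ))_Q` a regular local ring.

References: H. Matsumura, *Commutative Ring Theory*, Cambridge Stud. Adv. Math. 8, CUP 1986,
Thm. 30.4 (ii) [Matsumura1987]; the chart equations and their derivatives are folklore computations.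
-/

-- single-problem summit: the doubled namespace component is forced
set_option linter.dupNamespace false

noncomputable section

namespace Summit.ResolutionOfSingularities.ResolutionOfSingularities.Theorems.FInjectiveMacaulayfication.ThreefoldChartsAlongE

open MvPolynomial

/-- **Chart `0`, direction `X₁`**: `∂(X₁ + X₁²X₂ + X₂² + X₀X₃³ + X₀X₁X₂X₃²)/∂X₁ = 1 + X₀ · (X₂X₃²) + 2 · (X₁X₂)`
in `k[X₀, …, X₃]`, `k` any commutative ring. [folklore] -/
theorem pderiv_one_g₀ (k : Type) [CommRing k] :
    pderiv 1 (X 1 + X 1 ^ 2 * X 2 + X 2 ^ 2 + X 0 * X 3 ^ 3 + X 0 * X 1 * X 2 * X 3 ^ 2 :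
      MvPolynomial (Fin 4) k) = 1 + X 0 * (X 2 * X 3 ^ 2) + 2 * (X 1 * X 2) := by
  simp only [map_add, pderiv_mul, pderiv_pow, pderiv_X_self,
    pderiv_X_of_ne (show (0 : Fin 4) ≠ 1 by decide), pderiv_X_of_ne (show (2 : Fin 4) ≠ 1 by decide),
    pderiv_X_of_ne (show (3 : Fin 4) ≠ 1 by decide), Nat.cast_ofNat]
  ring

/-- **Chart `1`, direction `X₂`**: `∂(X₀² + X₂ + X₀X₂² + X₀X₁X₃³ + X₁X₂X₃²)/∂X₂ = 1 + X₁ · X₃² + 2 · (X₀X₂)`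
in `k[X₀, …, X₃]`, `k` any commutative ring. [folklore] -/
theorem pderiv_two_g₁ (k : Type) [CommRing k] :
    pderiv 2 (X 0 ^ 2 + X 2 + X 0 * X 2 ^ 2 + X 0 * X 1 * X 3 ^ 3 + X 1 * X 2 * X 3 ^ 2 :
      MvPolynomial (Fin 4) k) = 1 + X 1 * (X 3 ^ 2) + 2 * (X 0 * X 2) := by
  simp only [map_add, pderiv_mul, pderiv_pow, pderiv_X_self,
    pderiv_X_of_ne (show (0 : Fin 4) ≠ 2 by decide), pderiv_X_of_ne (show (1 : Fin 4) ≠ 2 by decide),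
    pderiv_X_of_ne (show (3 : Fin 4) ≠ 2 by decide), Nat.cast_ofNat]
  ring

/-- **Chart `2`, direction `X₀`**: `∂(X₀²X₁ + X₁² + X₀ + X₀X₂X₃³ + X₁X₂X₃²)/∂X₀ = 1 + X₂ · X₃³ + 2 · (X₀X₁)`
in `k[X₀, …, X₃]`, `k` any commutative ring. [folklore] -/
theorem pderiv_zero_g₂ (k : Type) [CommRing k] :
    pderiv 0 (X 0 ^ 2 * X 1 + X 1 ^ 2 + X 0 + X 0 * X 2 * X 3 ^ 3 + X 1 * X 2 * X 3 ^ 2 :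
      MvPolynomial (Fin 4) k) = 1 + X 2 * (X 3 ^ 3) + 2 * (X 0 * X 1) := by
  simp only [map_add, pderiv_mul, pderiv_pow, pderiv_X_self,
    pderiv_X_of_ne (show (1 : Fin 4) ≠ 0 by decide), pderiv_X_of_ne (show (2 : Fin 4) ≠ 0 by decide),
    pderiv_X_of_ne (show (3 : Fin 4) ≠ 0 by decide), Nat.cast_ofNat]
  ring

/-- **A Jacobian certificate `≡ 1 (mod x, 2)` does not vanish along `x = 0`**: in a commutative ring of
characteristic `2`, `1 + x · a + 2 · b ∉ P` for every proper ideal `P ∋ x` — indeed `2 = 0`, and otherwise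
`1 = (1 + x · a) - x · a ∈ P`. [folklore] -/
theorem one_add_mul_add_two_mul_not_mem {S : Type*} [CommRing S] [CharP S 2] (P : Ideal S)
    (hP : P ≠ ⊤) {x : S} (a b : S) (hx : x ∈ P) : 1 + x * a + 2 * b ∉ P := by
  intro hmem
  refine hP ((Ideal.eq_top_iff_one P).mpr ?_)
  rw [CharP.ofNat_eq_zero S 2, zero_mul, add_zero] at hmem
  have h1 := P.sub_mem hmem (P.mul_mem_right a hx)
  rwa [add_sub_cancel_right] at h1

/-- **Charts `0`, `1`, `2` of the blown-up threefold are regular along the exceptional divisor** (registered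
stub `stub_threefoldChartsAlongE` of the §13 threefold calibration): for a field `k` of characteristic `2`
and the strict transforms `g₀, g₁, g₂` of `f = X₀²X₁ + X₁²X₂ + X₂²X₀ + X₀X₃³ + X₁X₂X₃²` on the charts
`X₀ ≠ 0`, `X₁ ≠ 0`, `X₂ ≠ 0` of the blow-up of the origin, every prime `Q` of `k[X]/(gᵢ)` containing the
exceptional equation `x̄ᵢ` has a regular local ring `(k[X]/(gᵢ))_Q`. Proof: `P := Q ∩ k[X]` is a proper
ideal containing `Xᵢ`; the Jacobian certificates `∂g₀/∂X₁ = 1 + X₀ · (X₂X₃²) + 2 · (X₁X₂)`,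
`∂g₁/∂X₂ = 1 + X₁ · X₃² + 2 · (X₀X₂)`, `∂g₂/∂X₀ = 1 + X₂ · X₃³ + 2 · (X₀X₁)` are `≡ 1 (mod Xᵢ, 2)`, hence
not in `P` (`one_add_mul_add_two_mul_not_mem`), and the Jacobian criterion at an arbitrary prime
(`HypersurfaceRegular.stub_hypersurfaceRegularOfPderiv`, Matsumura Thm. 30.4 (ii)) concludes.
[cite: Matsumura1987, Thm. 30.4 (ii)] -/
theorem stub_threefoldChartsAlongE : ∀ (k : Type) [Field k] [CharP k 2] (g₀ g₁ g₂ : MvPolynomial (Fin 4) k),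
    g₀ = MvPolynomial.X 1 + MvPolynomial.X 1 ^ 2 * MvPolynomial.X 2 + MvPolynomial.X 2 ^ 2 + MvPolynomial.X 0 * MvPolynomial.X 3 ^ 3 + MvPolynomial.X 0 * MvPolynomial.X 1 * MvPolynomial.X 2 * MvPolynomial.X 3 ^ 2 →
    g₁ = MvPolynomial.X 0 ^ 2 + MvPolynomial.X 2 + MvPolynomial.X 0 * MvPolynomial.X 2 ^ 2 + MvPolynomial.X 0 * MvPolynomial.X 1 * MvPolynomial.X 3 ^ 3 + MvPolynomial.X 1 * MvPolynomial.X 2 * MvPolynomial.X 3 ^ 2 →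
    g₂ = MvPolynomial.X 0 ^ 2 * MvPolynomial.X 1 + MvPolynomial.X 1 ^ 2 + MvPolynomial.X 0 + MvPolynomial.X 0 * MvPolynomial.X 2 * MvPolynomial.X 3 ^ 3 + MvPolynomial.X 1 * MvPolynomial.X 2 * MvPolynomial.X 3 ^ 2 →
    (∀ (Q : Ideal (MvPolynomial (Fin 4) k ⧸ Ideal.span {g₀})) [Q.IsPrime],
      Ideal.Quotient.mk (Ideal.span {g₀}) (MvPolynomial.X 0) ∈ Q → IsRegularLocalRing (Localization.AtPrime Q)) ∧
    (∀ (Q : Ideal (MvPolynomial (Fin 4) k ⧸ Ideal.span {g₁})) [Q.IsPrime],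
      Ideal.Quotient.mk (Ideal.span {g₁}) (MvPolynomial.X 1) ∈ Q → IsRegularLocalRing (Localization.AtPrime Q)) ∧
    (∀ (Q : Ideal (MvPolynomial (Fin 4) k ⧸ Ideal.span {g₂})) [Q.IsPrime],
      Ideal.Quotient.mk (Ideal.span {g₂}) (MvPolynomial.X 2) ∈ Q → IsRegularLocalRing (Localization.AtPrime Q)) := by
  intro k _ _ g₀ g₁ g₂ hg₀ hg₁ hg₂
  -- `k[X₀, …, X₃]` inherits characteristic `2` from `k`
  haveI : CharP (MvPolynomial (Fin 4) k) 2 := inferInstance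
  subst hg₀ hg₁ hg₂
  refine ⟨fun Q hQ hX => ?_, fun Q hQ hX => ?_, fun Q hQ hX => ?_⟩
  · -- chart `0`: the certificate `∂g₀/∂X₁ ≡ 1 (mod X₀, 2)` is not in the proper prime `Q ∩ k[X] ∋ X₀`
    refine HypersurfaceRegular.stub_hypersurfaceRegularOfPderiv k 4 _ 1 Q ?_
    rw [pderiv_one_g₀]
    exact one_add_mul_add_two_mul_not_mem _ (Ideal.comap_ne_top _ hQ.ne_top) _ _ (Ideal.mem_comap.mpr hX)
  · -- chart `1`: the certificate `∂g₁/∂X₂ ≡ 1 (mod X₁, 2)`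
    refine HypersurfaceRegular.stub_hypersurfaceRegularOfPderiv k 4 _ 2 Q ?_
    rw [pderiv_two_g₁]
    exact one_add_mul_add_two_mul_not_mem _ (Ideal.comap_ne_top _ hQ.ne_top) _ _ (Ideal.mem_comap.mpr hX)
  · -- chart `2`: the certificate `∂g₂/∂X₀ ≡ 1 (mod X₂, 2)`
    refine HypersurfaceRegular.stub_hypersurfaceRegularOfPderiv k 4 _ 0 Q ?_
    rw [pderiv_zero_g₂]
    exact one_add_mul_add_two_mul_not_mem _ (Ideal.comap_ne_top _ hQ.ne_top) _ _ (Ideal.mem_comap.mpr hX)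

end Summit.ResolutionOfSingularities.ResolutionOfSingularities.Theorems.FInjectiveMacaulayfication.ThreefoldChartsAlongE

end
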